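import Summits.Ventures.PercRepro.ProfileGapMonoGenericAll

/-!
# PercRepro — THE TOP-BUT-ONE LEVEL OF THE CO-RANK-`q` ROW IN CLOSED FORM (p10, gen 8; `proofs/P10-AVFULL.md` §16)

At the level `u = ρ(E) − 1` the co-rank-`q` row `D_q(M; u) ≤ C(u,q) · W⁻_{q,u}(M)` has only two demand values
(`C(u,q)` on the rank-`q` sets whose complement has rank `u`, `C(u+1,q+1)` on those whose complement spans), and the
co-rank-`q` sets of level `u` whose complement has rank exactly `q` are the complements of the former
(`B ↦ E ∖ B`).  Cancelling them:

  `Π⁻_{q,ρ−1}  ⟺  C(ρ, q+1) · #{B : ρ(B) = q, E ∖ B spanning} ≤ C(ρ−1, q) · #{S : ρ(S) = ρ−1, ρ(E ∖ S) ≥ q+1}`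

(`profileIneqMinusQ_top_but_one_iff`; equivalently `ρ · N(q,ρ) ≤ (q+1) · N(ρ−1, ≥ q+1)`).  Tight on `U_{R,R+q}` for
every `R`.  For `q = 2` the statement is a theorem (ProfileGapMonoTwoRow); for `q ≥ 3` it is the first open level of
the hard rule `HardRuleQ''`, stated here in the form a proof would use.

* `sum_demand_top_but_one`, `card_levelSetCoQ_top_but_one`, `card_filter_Rq_eq_card_filter_levelSetCoQ`,
  **`profileIneqMinusQ_top_but_one_iff`**.
-/

open scoped Matroid

namespace PercRepro.Cogirth

open Finset ThmH Skew Shadow Profile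

variable {α : Type} [DecidableEq α] {M : Matroid α} [M.Finite]

/-- At the level `u = ρ(E) − 1` the demand sum has two terms: `C(u,q)` per rank-`q` set whose complement has rank
`u`, `C(u+1,q+1)` per rank-`q` set whose complement spans. -/
theorem sum_demand_top_but_one {q u : ℕ} (hq : q ≤ u) (hu : u + 1 = rk M (gr M)) :
    ∑ B ∈ Rq M q, demand M q u B =
      u.choose q * ((Rq M q).filter (fun B => rk M (gr M \ B) = u)).card +
        (u + 1).choose (q + 1) * ((Rq M q).filter (fun B => rk M (gr M \ B) = u + 1)).card := by
  have hterm : ∀ B ∈ Rq M q, demand M q u B =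
      (if rk M (gr M \ B) = u then u.choose q else 0) +
        (if rk M (gr M \ B) = u + 1 then (u + 1).choose (q + 1) else 0) := by
    intro B _
    have hle : rk M (gr M \ B) ≤ u + 1 := hu ▸ rk_mono_sub sdiff_subset
    unfold demand
    rcases (show rk M (gr M \ B) = u + 1 ∨ rk M (gr M \ B) = u ∨ rk M (gr M \ B) < u by omega) with h | h | h
    · rw [h, if_pos (by omega), if_neg (by omega), if_pos rfl, zero_add,
        show u - q = u + 1 - (q + 1) by omega, Nat.choose_symm (by omega)]
    · rw [h, if_pos (le_refl _), if_pos rfl, if_neg (by omega), add_zero, Nat.choose_symm hq]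
    · rw [if_neg (by omega), if_neg (by omega), if_neg (by omega)]
  rw [sum_congr rfl hterm, sum_add_distrib, ← sum_filter, ← sum_filter, sum_const, sum_const, smul_eq_mul,
    smul_eq_mul, mul_comm _ (u.choose q), mul_comm _ ((u + 1).choose (q + 1))]

/-- The co-rank-`q` level set at the level `u` splits by the rank of the complement: exactly `q`, or at least
`q + 1`. -/
theorem card_levelSetCoQ_top_but_one (q u : ℕ) :
    (levelSetCoQ M q u).card =
      ((levelSetCoQ M q u).filter (fun S => rk M (gr M \ S) = q)).card +
        ((levelSetCoQ M q u).filter (fun S => q + 1 ≤ rk M (gr M \ S))).card := by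
  have h := Finset.card_filter_add_card_filter_not (s := levelSetCoQ M q u)
    (fun S => rk M (gr M \ S) = q)
  have h2 : (levelSetCoQ M q u).filter (fun S => ¬ rk M (gr M \ S) = q) =
      (levelSetCoQ M q u).filter (fun S => q + 1 ≤ rk M (gr M \ S)) := by
    apply filter_congr
    intro S hS
    rw [mem_levelSetCoQ] at hS
    constructor <;> intro h' <;> omega
  rw [← h, h2]

/-- `B ↦ E ∖ B` is a bijection from the rank-`q` sets whose complement has rank `u` onto the rank-`u` sets whose
complement has rank exactly `q`. -/
theorem card_filter_Rq_eq_card_filter_levelSetCoQ (q u : ℕ) :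
    ((Rq M q).filter (fun B => rk M (gr M \ B) = u)).card =
      ((levelSetCoQ M q u).filter (fun S => rk M (gr M \ S) = q)).card := by
  apply card_bij (fun B _ => gr M \ B)
  · intro B hB
    rw [mem_filter, mem_Rq] at hB
    obtain ⟨⟨hBg, hBr⟩, hBu⟩ := hB
    have hrq : rk M B = q := by unfold rk; rw [hBr, ENat.toNat_coe]
    rw [mem_filter, mem_levelSetCoQ, Finset.sdiff_sdiff_eq_self hBg, hrq]
    refine ⟨⟨⟨sdiff_subset, ?_⟩, le_refl _⟩, rfl⟩
    rw [← coe_rk, hBu]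
  · intro B hB B' hB' heq
    have hBg : B ⊆ gr M := (mem_Rq.1 (mem_filter.1 hB).1).1
    have hB'g : B' ⊆ gr M := (mem_Rq.1 (mem_filter.1 hB').1).1
    rw [← Finset.sdiff_sdiff_eq_self hBg, ← Finset.sdiff_sdiff_eq_self hB'g, heq]
  · intro S hS
    rw [mem_filter, mem_levelSetCoQ] at hS
    obtain ⟨⟨⟨hSg, hSr⟩, _⟩, hSq⟩ := hS
    refine ⟨gr M \ S, ?_, Finset.sdiff_sdiff_eq_self hSg⟩
    rw [mem_filter, mem_Rq, Finset.sdiff_sdiff_eq_self hSg]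
    refine ⟨⟨sdiff_subset, ?_⟩, ?_⟩
    · rw [← coe_rk, hSq]
    · unfold rk
      rw [hSr, ENat.toNat_coe]

/-- **THE TOP-BUT-ONE LEVEL IN CLOSED FORM**: for `q < u = ρ(E) − 1`,
`Π⁻_{q,u}  ⟺  C(u+1,q+1) · #{B : ρ(B) = q, E ∖ B spanning} ≤ C(u,q) · #{S : ρ(S) = u, ρ(E ∖ S) ≥ q + 1}`. -/
theorem profileIneqMinusQ_top_but_one_iff {q u : ℕ} (hq : q ≤ u) (hu : u + 1 = rk M (gr M)) :
    ProfileIneqMinusQ M q u ↔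
      (u + 1).choose (q + 1) * ((Rq M q).filter (fun B => rk M (gr M \ B) = u + 1)).card ≤
        u.choose q * ((levelSetCoQ M q u).filter (fun S => q + 1 ≤ rk M (gr M \ S))).card := by
  unfold ProfileIneqMinusQ
  rw [sum_demand_top_but_one hq hu, card_levelSetCoQ_top_but_one q u, ← card_filter_Rq_eq_card_filter_levelSetCoQ,
    Nat.mul_add]
  omega

end PercRepro.Cogirth
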